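import Mathlib
import HarnessLib
import Summits.NavierStokesRegularity.NavierStokesRegularity.Theorems.PoloidalWindowDoorPoloidalWindowRigiditySymmetryGerms
import Summits.NavierStokesRegularity.NavierStokesRegularity.Theorems.PoloidalWindowDoorPoloidalWindowRigidityTimeHeightShearNormalForm
import Summits.NavierStokesRegularity.NavierStokesRegularity.Theorems.PoloidalWindowDoorPoloidalWindowRigidityClebsch
import Summits.NavierStokesRegularity.NavierStokesRegularity.Theorems.PoloidalWindowDoorLrcModEntireTwistingTHOscLiouville
import Summits.NavierStokesRegularity.NavierStokesRegularity.Theorems.PoloidalWindowDoorLrcModEntireTwistingTHPlaneOscillationLink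

/-!
# Item `LrcModEntire` (stmt-NavierStokesRegularity-20428), skeleton twist_split v6 — the CLASS road to `stub_twistingTHGerm` BY NAME, MAJORANT FORM:
# `stub_twistingTHGerm` ⇐ «the weighted plane oscillation of v₂ admits a bounded C² similarity majorant obeying (OSC)» (no vorticity/link clause)

Cell ns-regularity-ideate, LEAD ns-poloidal-K2-p3 g13 (`--supports stmt-NavierStokesRegularity-20428`; sequel of `…TwistingTHOscRoad` (p687098), whose hypothesis
object still carried the LINK «Q = 0 ⇒ ω = 0 on the plane»; here the link is DISCHARGED from the (TH) structure by `…TwistingTHPlaneOscillationLink` +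
`…TimeHeightShearNormalForm`, so the hypothesis object is purely analytic: the `_anyK` conjuncts for some `(Q, Qt, Ŝ)` plus the MAJORANT inequality
`√(−t)·|(1 − μ)(v₂(t,y) − v₂(t,y′))| ≤ Q(τ,ξ)` for all `y, y′` on every proportional-shear plane `{y₂ = z}` (slope `μ`) — `τ = −log(−t)`, `ξ = z/√(−t)`).

* `eq_zero_of_similarityMajorant` — class + poloidal + a (TH) window + the analytic object ⇒ `v ≡ 0`.  Proof: `eq_zero_of_ancient_oscSubsolution_anyK` ⇒ `Q ≡ 0`
  ⇒ on every proportional-shear plane of the slice `t = −1` the weight oscillation vanishes ⇒ (`curl_eq_zero_on_plane_of_weightOsc_zero`) the vorticity vanishes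
  there; by `timeHeightShear_normalForm` every plane is flat or proportional-shear; flat planes on an open height set already force `v ≡ 0`
  (`eq_zero_of_flatPlanes_open`); otherwise non-flatness is open in the height, so `curl v(−1) = 0` on an open slab and `eq_zero_of_curl_eq_zero_on_open` ends.
* `twistingTHGerm_of_similarityMajorant` — the registered signature of `stub_twistingTHGerm` VERBATIM from the object supplied per normalised windowed profile.
So the (TH) column = EXACTLY «(h1) the scale-invariant bound + (h2) a C² FP-subsolution majorant» (memo OSC-LIOUVILLE-g13 v1.3 §5).

WHAT THIS IS NOT: not a claim about Navier–Stokes regularity and not a proof of the stub — a reduction BY NAME to a typed analytic hypothesis (bears_on LADDER-NS N0,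
item 20428 / crux 19708; both OPEN).
-/

noncomputable section

-- the summit and its single sub-problem share the name (CONVENTIONS §1), as in every Theorems file
set_option linter.dupNamespace false

namespace Summit.NavierStokesRegularity.NavierStokesRegularity.Theorems.PoloidalWindowDoorLrcModEntireTwistingTHOscRoadMajorant

open Set Filter Topology Function
open scoped RealInnerProductSpace InnerProductSpace Laplacian
open Literature.Analysis Literature.Analysis.FluidPDE
open Summit.NavierStokesRegularity.NavierStokesRegularity.Theorems.PoloidalWindowDoorPoloidalWindowRigiditySymmetryGerms
open Summit.NavierStokesRegularity.NavierStokesRegularity.Theorems.PoloidalWindowDoorPoloidalWindowRigidityTimeHeightShearNormalForm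
open Summit.NavierStokesRegularity.NavierStokesRegularity.Theorems.PoloidalWindowDoorPoloidalWindowRigidityClebsch
open Summit.NavierStokesRegularity.NavierStokesRegularity.Theorems.PoloidalWindowDoorLrcModEntireTwistingTHOscLiouville
open Summit.NavierStokesRegularity.NavierStokesRegularity.Theorems.PoloidalWindowDoorLrcModEntireTwistingTHPlaneOscillationLink

/-- **Non-flatness of a plane is open in the height** for a `C¹` field: if `(∂_b V)₂(y₀) ≠ 0` at a point of height `c₀`, then every plane
`{y₂ = c}` with `c` near `c₀` carries a point with `(∂_b V)₂ ≠ 0` (namely `y₀ + (c − c₀)e₂`). -/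
theorem nonflat_nhds {V : EuclideanSpace ℝ (Fin 3) → EuclideanSpace ℝ (Fin 3)} (hV : ContDiff ℝ 1 V)
    {y₀ : EuclideanSpace ℝ (Fin 3)} {b : Fin 3} (hne : fderiv ℝ V y₀ (EuclideanSpace.single b 1) 2 ≠ 0) :
    ∀ᶠ c in 𝓝 (y₀ 2), ∃ y : EuclideanSpace ℝ (Fin 3), y 2 = c ∧ fderiv ℝ V y (EuclideanSpace.single b 1) 2 ≠ 0 := by
  -- `c ↦ (∂_b V)₂(y₀ + (c − c₀)e₂)` is continuous and non-zero at `c₀`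
  set g : ℝ → ℝ := fun c => fderiv ℝ V (y₀ + (c - y₀ 2) • EuclideanSpace.single 2 (1 : ℝ)) (EuclideanSpace.single b 1) 2 with hg
  have hcd : Continuous (fderiv ℝ V) := hV.continuous_fderiv one_ne_zero
  have hgc : Continuous g := by
    have h1 : Continuous fun c : ℝ => y₀ + (c - y₀ 2) • EuclideanSpace.single 2 (1 : ℝ) := by fun_prop
    have h2 : Continuous fun c : ℝ => fderiv ℝ V (y₀ + (c - y₀ 2) • EuclideanSpace.single 2 (1 : ℝ)) (EuclideanSpace.single b 1) :=
      (hcd.comp h1).clm_apply continuous_const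
    exact (EuclideanSpace.proj (𝕜 := ℝ) (2 : Fin 3)).continuous.comp h2
  have hg0 : g (y₀ 2) ≠ 0 := by simpa [hg] using hne
  have hev : ∀ᶠ c in 𝓝 (y₀ 2), g c ≠ 0 := (hgc.continuousAt.eventually_ne hg0)
  filter_upwards [hev] with c hc
  exact ⟨y₀ + (c - y₀ 2) • EuclideanSpace.single 2 (1 : ℝ), by simp, hc⟩

/-- **CLASS + POLOIDAL + (TH) WINDOW + THE ANALYTIC OBJECT ⇒ `v ≡ 0`.**  The object: `(Q, Qt, Ŝ)` with the regularity/bounds/subsolution conjuncts of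
`eq_zero_of_ancient_oscSubsolution_anyK` and the MAJORANT inequality on every proportional-shear plane:
`√(−t)·|(1−μ)(v₂(t,y) − v₂(t,y′))| ≤ Q(−log(−t), z/√(−t))` (`y₂ = y′₂ = z`, slope `μ`). -/
theorem eq_zero_of_similarityMajorant {C : ℝ} {v : ℝ → EuclideanSpace ℝ (Fin 3) → EuclideanSpace ℝ (Fin 3)}
    (hrate : HasTypeITimeDecay C v) (hcont : ContinuousOn (uncurry v) (Iio (0 : ℝ) ×ˢ univ))
    (hmild : ∀ s t : ℝ, s < t → t < 0 → ∀ x,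
      v t x = UnboundedOperators.heatExtension (v s) (t - s) x - oseenDuhamel 1 s v v t x)
    (hdiv : ∀ t < 0, VectorCalculus.IsDivFree (v t))
    (hpol : ∀ s < 0, ∀ y, ⟪curl (v s) y, EuclideanSpace.single 2 1⟫_ℝ = 0)
    {W : Set (ℝ × EuclideanSpace ℝ (Fin 3))} (hW : IsOpen W) (hWne : W.Nonempty) (hWs : W ⊆ Iio (0 : ℝ) ×ˢ univ)
    {m : ℝ → ℝ → ℝ}
    (hTH : ∀ z ∈ W, ∀ b : Fin 3, b ≠ 2 →
      fderiv ℝ (v z.1) z.2 (EuclideanSpace.single 2 1) b = m z.1 (z.2 2) * fderiv ℝ (v z.1) z.2 (EuclideanSpace.single b 1) 2)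
    (hObj : ∃ (Q Qt S : ℝ → ℝ → ℝ) (A c K : ℝ) (k : ℕ), 0 < A ∧
      (∀ τ, ContDiff ℝ 2 (Q τ)) ∧ (∀ τ ξ, HasDerivAt (fun τ' => Q τ' ξ) (Qt τ ξ) τ) ∧ (∀ τ, Continuous (Qt τ)) ∧
      (∀ τ ξ, 0 ≤ Q τ ξ) ∧ (∀ τ ξ, Q τ ξ ≤ c) ∧
      (∀ τ ξ, |Qt τ ξ| ≤ K * (1 + ξ ^ 2) ^ k) ∧ (∀ τ ξ, |deriv (Q τ) ξ| ≤ K * (1 + ξ ^ 2) ^ k) ∧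
      (∀ τ ξ, |deriv (deriv (Q τ)) ξ| ≤ K * (1 + ξ ^ 2) ^ k) ∧
      (∀ τ, ContDiff ℝ 1 (S τ)) ∧ (∀ τ ξ, |S τ ξ| ≤ A) ∧ (∀ τ ξ, |deriv (S τ) ξ| ≤ K * (1 + ξ ^ 2) ^ k) ∧
      (∀ τ ξ, Qt τ ξ + (1 / 2 : ℝ) * deriv (fun ξ => (ξ + S τ ξ) * Q τ ξ) ξ ≤ deriv (deriv (Q τ)) ξ) ∧
      (∀ t : ℝ, t < 0 → ∀ z μ : ℝ,
        (∀ y : EuclideanSpace ℝ (Fin 3), y 2 = z → ∀ b : Fin 3, b ≠ 2 →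
          fderiv ℝ (v t) y (EuclideanSpace.single 2 1) b = μ * fderiv ℝ (v t) y (EuclideanSpace.single b 1) 2) →
        ∀ y y' : EuclideanSpace ℝ (Fin 3), y 2 = z → y' 2 = z →
          Real.sqrt (-t) * |(1 - μ) * (v t y 2 - v t y' 2)| ≤ Q (-Real.log (-t)) (z / Real.sqrt (-t)))) :
    ∀ t < 0, ∀ x, v t x = 0 := by
  obtain ⟨Q, Qt, S, A, c, K, k, hA, hQ2, hQt, hQtc, h0, hc, hQtb, hQ1b, hQ2b, hS, hSA, hS1b, hsub, hmaj⟩ := hObj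
  have hQ0 : ∀ τ ξ, Q τ ξ = 0 :=
    eq_zero_of_ancient_oscSubsolution_anyK hA hQ2 hQt hQtc h0 hc hQtb hQ1b hQ2b hS hSA hS1b hsub
  have hs : (-1 : ℝ) < 0 := by norm_num
  -- the slice `t = −1`
  have hV1 : ContDiff ℝ 1 (v (-1)) := (contDiff_slice hrate hcont hmild hs).of_le (by norm_cast)
  have hVd : Differentiable ℝ (v (-1)) := hV1.differentiable one_ne_zero
  have hpol1 : ∀ y : EuclideanSpace ℝ (Fin 3), curl (v (-1)) y 2 = 0 := fun y =>
    curl_apply_two_eq_zero_of_inner (hpol (-1) hs y)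
  -- on a proportional-shear plane of the slice `−1`, the weight oscillation vanishes, hence so does the vorticity
  have hshear : ∀ z μ : ℝ, (∀ y : EuclideanSpace ℝ (Fin 3), y 2 = z → ∀ b : Fin 3, b ≠ 2 →
      fderiv ℝ (v (-1)) y (EuclideanSpace.single 2 1) b = μ * fderiv ℝ (v (-1)) y (EuclideanSpace.single b 1) 2) →
      ∀ y : EuclideanSpace ℝ (Fin 3), y 2 = z → curl (v (-1)) y = 0 := by
    intro z μ hμ y hy
    refine curl_eq_zero_on_plane_of_weightOsc_zero hVd hμ (fun y' hy' => hpol1 y') (fun y₁ y₂ h1 h2 => ?_) hy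
    have h := hmaj (-1) hs z μ hμ y₁ y₂ h1 h2
    rw [hQ0] at h
    have h' : |(1 - μ) * (v (-1) y₁ 2 - v (-1) y₂ 2)| ≤ 0 := by simpa using h
    exact abs_eq_zero.1 (le_antisymm h' (abs_nonneg _))
  -- dichotomy on the slice `−1`: every plane is flat or proportional-shear
  have hNF := timeHeightShear_normalForm hrate hcont hmild hW hWne hWs hTH (-1) hs
  by_cases hall : ∀ cc : ℝ, ∀ y : EuclideanSpace ℝ (Fin 3), y 2 = cc →
      fderiv ℝ (v (-1)) y (EuclideanSpace.single 0 1) 2 = 0 ∧ fderiv ℝ (v (-1)) y (EuclideanSpace.single 1 1) 2 = 0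
  · -- every plane of the slice is flat ⇒ `v ≡ 0`
    exact eq_zero_of_flatPlanes_open hrate hcont hmild hdiv hpol hs isOpen_univ univ_nonempty fun cc _ y hy => hall cc y hy
  · push Not at hall
    obtain ⟨c₀, y₀, hy₀, hne⟩ := hall
    -- a non-flat point `y₀` of height `c₀`: one of the two horizontal derivatives of `v₂` is non-zero
    have hne' : ∃ b : Fin 3, b ≠ 2 ∧ fderiv ℝ (v (-1)) y₀ (EuclideanSpace.single b 1) 2 ≠ 0 := by
      by_cases h0 : fderiv ℝ (v (-1)) y₀ (EuclideanSpace.single 0 1) 2 = 0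
      · exact ⟨1, by decide, hne h0⟩
      · exact ⟨0, by decide, h0⟩
    obtain ⟨b, hb, hneb⟩ := hne'
    -- non-flatness persists on nearby heights: an open interval `I ∋ c₀` of non-flat planes
    have hev := nonflat_nhds hV1 (b := b) hneb
    rw [hy₀] at hev
    obtain ⟨ε, hε, hball⟩ := Metric.eventually_nhds_iff.1 hev
    have hcurl : ∀ y ∈ {y : EuclideanSpace ℝ (Fin 3) | y 2 ∈ Metric.ball c₀ ε}, curl (v (-1)) y = 0 := by
      intro y hy
      obtain ⟨y₁, hy₁, hne₁⟩ := hball hy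
      -- the plane `y 2` is not flat, hence proportional-shear with some slope
      rcases hNF (y 2) with hflat | ⟨μ, hμ⟩
      · exact absurd ((fun h => by fin_cases b <;> simp_all) (hflat y₁ hy₁)) (by simpa using hne₁)
      · exact hshear (y 2) μ hμ y rfl
    have hU : IsOpen {y : EuclideanSpace ℝ (Fin 3) | y 2 ∈ Metric.ball c₀ ε} :=
      Metric.isOpen_ball.preimage (EuclideanSpace.proj (𝕜 := ℝ) (2 : Fin 3)).continuous
    have hUne : ({y : EuclideanSpace ℝ (Fin 3) | y 2 ∈ Metric.ball c₀ ε}).Nonempty :=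
      ⟨y₀, by simpa [hy₀] using hε⟩
    exact eq_zero_of_curl_eq_zero_on_open hrate hcont hmild hdiv hs hU hUne hcurl

/-- **THE CLASS ROAD TO `stub_twistingTHGerm` BY NAME, MAJORANT FORM.**  If every poloidal class profile normalised at the hot spot and carrying a (TH) window
(the binders of the registered stub) admits the analytic object of `eq_zero_of_similarityMajorant`, then the registered signature of `stub_twistingTHGerm`
(skeleton `Cruxes/LrcModEntire/Lines/twist_split.lean` v6) holds — such a profile is `≡ 0`, contradicting `v₂(−1,0) ≠ 0`. -/
theorem twistingTHGerm_of_similarityMajorant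
    (hH : ∀ (C : ℝ) (v : ℝ → EuclideanSpace ℝ (Fin 3) → EuclideanSpace ℝ (Fin 3)),
      Literature.Analysis.FluidPDE.HasTypeITimeDecay C v →
      ContinuousOn (Function.uncurry v) (Set.Iio (0 : ℝ) ×ˢ Set.univ) →
      (∀ s t : ℝ, s < t → t < 0 → ∀ x, v t x =
        Literature.Analysis.UnboundedOperators.heatExtension (v s) (t - s) x -
          Literature.Analysis.FluidPDE.oseenDuhamel 1 s v v t x) →
      (∀ t < 0, Literature.Analysis.FluidPDE.VectorCalculus.IsDivFree (v t)) →
      (∀ s < 0, ∀ y, ⟪Literature.Analysis.FluidPDE.curl (v s) y, EuclideanSpace.single 2 1⟫_ℝ = 0) →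
      v (-1) 0 2 ≠ 0 → (∀ t < 0, ∀ x, Real.sqrt (-t) * |v t x 2| ≤ |v (-1) 0 2|) →
      ∀ W : Set (ℝ × EuclideanSpace ℝ (Fin 3)), IsOpen W → W.Nonempty → W ⊆ Set.Iio (0 : ℝ) ×ˢ Set.univ →
        (∃ m : ℝ → ℝ → ℝ, ∀ z ∈ W, ∀ b : Fin 3, b ≠ 2 →
            fderiv ℝ (v z.1) z.2 (EuclideanSpace.single 2 1) b =
              m z.1 (z.2 2) * fderiv ℝ (v z.1) z.2 (EuclideanSpace.single b 1) 2) →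
        ∃ (Q Qt S : ℝ → ℝ → ℝ) (A c K : ℝ) (k : ℕ), 0 < A ∧
          (∀ τ, ContDiff ℝ 2 (Q τ)) ∧ (∀ τ ξ, HasDerivAt (fun τ' => Q τ' ξ) (Qt τ ξ) τ) ∧ (∀ τ, Continuous (Qt τ)) ∧
          (∀ τ ξ, 0 ≤ Q τ ξ) ∧ (∀ τ ξ, Q τ ξ ≤ c) ∧
          (∀ τ ξ, |Qt τ ξ| ≤ K * (1 + ξ ^ 2) ^ k) ∧ (∀ τ ξ, |deriv (Q τ) ξ| ≤ K * (1 + ξ ^ 2) ^ k) ∧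
          (∀ τ ξ, |deriv (deriv (Q τ)) ξ| ≤ K * (1 + ξ ^ 2) ^ k) ∧
          (∀ τ, ContDiff ℝ 1 (S τ)) ∧ (∀ τ ξ, |S τ ξ| ≤ A) ∧ (∀ τ ξ, |deriv (S τ) ξ| ≤ K * (1 + ξ ^ 2) ^ k) ∧
          (∀ τ ξ, Qt τ ξ + (1 / 2 : ℝ) * deriv (fun ξ => (ξ + S τ ξ) * Q τ ξ) ξ ≤ deriv (deriv (Q τ)) ξ) ∧
          (∀ t : ℝ, t < 0 → ∀ z μ : ℝ,
            (∀ y : EuclideanSpace ℝ (Fin 3), y 2 = z → ∀ b : Fin 3, b ≠ 2 →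
              fderiv ℝ (v t) y (EuclideanSpace.single 2 1) b = μ * fderiv ℝ (v t) y (EuclideanSpace.single b 1) 2) →
            ∀ y y' : EuclideanSpace ℝ (Fin 3), y 2 = z → y' 2 = z →
              Real.sqrt (-t) * |(1 - μ) * (v t y 2 - v t y' 2)| ≤ Q (-Real.log (-t)) (z / Real.sqrt (-t)))) :
    ∀ (C : ℝ) (v : ℝ → EuclideanSpace ℝ (Fin 3) → EuclideanSpace ℝ (Fin 3)),
      Literature.Analysis.FluidPDE.HasTypeITimeDecay C v →
      ContinuousOn (Function.uncurry v) (Set.Iio (0 : ℝ) ×ˢ Set.univ) →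
      (∀ s t : ℝ, s < t → t < 0 → ∀ x, v t x =
        Literature.Analysis.UnboundedOperators.heatExtension (v s) (t - s) x -
          Literature.Analysis.FluidPDE.oseenDuhamel 1 s v v t x) →
      (∀ t < 0, Literature.Analysis.FluidPDE.VectorCalculus.IsDivFree (v t)) →
      (∀ s < 0, ∀ y, ⟪Literature.Analysis.FluidPDE.curl (v s) y, EuclideanSpace.single 2 1⟫_ℝ = 0) →
      v (-1) 0 2 ≠ 0 → (∀ t < 0, ∀ x, Real.sqrt (-t) * |v t x 2| ≤ |v (-1) 0 2|) →
      (∀ h : EuclideanSpace ℝ (Fin 3), fderiv ℝ (v (-1)) 0 h 2 = 0) →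
      (deriv (fun s => v s 0 2) (-1) = v (-1) 0 2 / 2 ∧ v (-1) 0 2 * (Δ (fun y => v (-1) y 2)) 0 ≤ 0) →
      ∀ W : Set (ℝ × EuclideanSpace ℝ (Fin 3)), IsOpen W → W.Nonempty → W ⊆ Set.Iio (0 : ℝ) ×ˢ Set.univ →
        (∀ z ∈ W, (Literature.Analysis.FluidPDE.curl (v z.1) z.2 ≠ 0 ∧
            (fderiv ℝ (v z.1) z.2 (EuclideanSpace.single 0 1) 2 ≠ 0 ∨ fderiv ℝ (v z.1) z.2 (EuclideanSpace.single 1 1) 2 ≠ 0) ∧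
            (fderiv ℝ (v z.1) z.2 (EuclideanSpace.single 2 1) 0 ≠ 0 ∨ fderiv ℝ (v z.1) z.2 (EuclideanSpace.single 2 1) 1 ≠ 0))) →
        (∀ m : ℝ → ℝ, ∀ W₁ : Set (ℝ × EuclideanSpace ℝ (Fin 3)), W₁ ⊆ W → IsOpen W₁ → W₁.Nonempty →
            ∃ z ∈ W₁, ∃ b : Fin 3, b ≠ 2 ∧
              fderiv ℝ (v z.1) z.2 (EuclideanSpace.single 2 1) b ≠
                m z.1 * fderiv ℝ (v z.1) z.2 (EuclideanSpace.single b 1) 2) →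
        (∀ z ∈ W, (fderiv ℝ (fun x => fderiv ℝ (v z.1) x (EuclideanSpace.single 2 1) 2) z.2 (EuclideanSpace.single 0 1) *
                fderiv ℝ (v z.1) z.2 (EuclideanSpace.single 1 1) 2 -
              fderiv ℝ (fun x => fderiv ℝ (v z.1) x (EuclideanSpace.single 2 1) 2) z.2 (EuclideanSpace.single 1 1) *
                fderiv ℝ (v z.1) z.2 (EuclideanSpace.single 0 1) 2 ≠ 0)) →
        (∃ m : ℝ → ℝ → ℝ, ∀ z ∈ W, ∀ b : Fin 3, b ≠ 2 →
            fderiv ℝ (v z.1) z.2 (EuclideanSpace.single 2 1) b =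
              m z.1 (z.2 2) * fderiv ℝ (v z.1) z.2 (EuclideanSpace.single b 1) 2) →
        ∃ s : ℝ, s < 0 ∧ ∃ U : Set (EuclideanSpace ℝ (Fin 3)), IsOpen U ∧ U.Nonempty ∧
          ((∃ e : EuclideanSpace ℝ (Fin 3), e ≠ 0 ∧
              ∀ y ∈ U, fderiv ℝ (Literature.Analysis.FluidPDE.curl (v s)) y e = 0) ∨
           (∃ c : EuclideanSpace ℝ (Fin 3), ∀ y ∈ U,
              Literature.Analysis.FluidPDE.rotGen (Literature.Analysis.FluidPDE.curl (v s) y) =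
                fderiv ℝ (Literature.Analysis.FluidPDE.curl (v s)) y (Literature.Analysis.FluidPDE.rotGen (y - c))) ∨
           (∃ w : EuclideanSpace ℝ (Fin 3) → EuclideanSpace ℝ (Fin 3), AnalyticOnNhd ℝ w Set.univ ∧
              ¬ BddAbove (Set.range fun y => ‖w y‖) ∧ ∀ y ∈ U, v s y = w y)) := by
  intro C v hrate hcont hmild hdiv hpol hne hhot _hthread _hpins W hW hWne hWs _hnd _hpin _htw hTH
  obtain ⟨m, hm⟩ := hTH
  have hzero := eq_zero_of_similarityMajorant hrate hcont hmild hdiv hpol hW hWne hWs hm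
    (hH C v hrate hcont hmild hdiv hpol hne hhot W hW hWne hWs ⟨m, hm⟩)
  have h0 : v (-1) 0 = 0 := hzero (-1) (by norm_num) 0
  exact absurd (by rw [h0]; rfl) hne

end Summit.NavierStokesRegularity.NavierStokesRegularity.Theorems.PoloidalWindowDoorLrcModEntireTwistingTHOscRoadMajorant
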